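import Literature.AlgebraicGeometry.Modules.DeterminantSectionOfSections
import Literature.AlgebraicGeometry.Morphisms.ProjectiveFrameLocus
import Literature.AlgebraicGeometry.Morphisms.ProjectiveSpaceOverBasePoints
import Literature.AlgebraicGeometry.Motives.GeneratingSectionsToProjRatios
import Literature.AlgebraicGeometry.Motives.GeneratingSectionsComap
import Literature.AlgebraicGeometry.Motives.GeneratingSectionsOfLineBundle
import Literature.AlgebraicGeometry.Motives.GeneratingSectionsOfCocycleComap
import HarnessLib

/-!
# The frame locus of marked points of `X → ℙ(f_*𝓛)` is cut out by evaluation determinants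

Topic `AlgebraicGeometry/Modules`; namespace `Literature.AlgebraicGeometry.Modules`.  THEOREMS ONLY (no definition, no
named fact, no instance, no notation, no `sorry`), over ★ `Modules/EvaluationDeterminant` / ★ `Modules/DeterminantSectionOfSections`
(`evalAtSection`, `evalDet`, `FrameSystem.evalDet`, `basicOpen_evalDet_eq`, `FrameSystem.map_evalDet`) and ★
`Morphisms/ProjectiveFrameLocus` (`ProjFrame.chartOpen`, `ProjFrame.coord`, `ProjFrame.frameDetSection`, `ProjFrame.frameLocus`).
Cell `hodgecm-mathlib` (D-0151), F-DAG F-9 (9b) rows (E6)(E7) «chart seam» (consumer (M1)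
`ModuliOfAbelianVarieties/SiegelModuliIntrinsicSections` §3); count-neutral: HC_CM is proved only modulo the 7 printed
citations until rung 0 closes — nothing here bears on a summit statement.

SETTING ([Hartshorne1977] II Thm. 7.1 (b), [MumfordFogartyKirwan1994] Ch. 3 §1 Definition 3.3 (p. 68)).  `f : X → T`, `𝓛` an
`𝒪_X`-module with a rank-one frame system `FL`, `b₀, …, b_d` a frame of `f_*𝓛` (`e`, `d = Nat.card J`) whose members generate
`𝓛` (`hcov`), `ι : X → ℙ^d_ℤ` the morphism of the sections `bᵢ` (★ `projectiveSpace.homEquiv` of ★ `pointOfSections` of the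
generating-sections datum ★ `ofCocycleSections` of the coefficient cocycle sections ★ `CocycleSections.ofFrameSystem`), and
`d + 2` sections `x_j : T → X` of `f`.  MFK's open `U_R ⊂ (ℙ^d)^{d+2}` («`D_{0,…,n} ≠ 0`, `D_{0,…,î,…,n,n+1} ≠ 0`») pulled back
along the tuple `(x_j ≫ ι)_j` is ★ `ProjFrame.frameLocus`; this file identifies it, on any refinement `W t` of local frames
`FE_t` of `f_*𝓛` and `G_j` of `x_j^*𝓛`, with the common non-vanishing locus of the `d + 2` EVALUATION DETERMINANTS
`det (b_i(x_j))_{i, j ≠ k}` of ★ `FrameSystem.evalDet`: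

* §1 `comp_homEquiv_pointOfSections_eq_toProj_comap` — `x_j ≫ ι` is ★ `toProj` of the pulled-back datum `(x_j^*𝓛, x_j^*bᵢ)`;
  `appLE_ratio_mul_appLE_coeff`, `isUnit_appLE_coeff` — (E6, columns) the chart ratios of `x_j ≫ ι` are quotients of
  pulled-back coefficients; `coord_evalAtSection_app_eq_appLE_coeffAt` — (E6, entries) the evaluation-matrix entries in the
  pulled-back local generators ARE the pulled-back coefficients.
* §2 `basicOpen_frameDetSection_inf_eq_of_coord_mul` — stalkwise MFK Def. 3.3: in a chart, the frame condition is the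
  invertibility of all maximal minors of any column-normalised coordinate matrix (★ `IsUnitFrame.rowScale`,
  ★ `isUnitFrame_iff_forall_isUnit_det_minor`).
* §3 `mem_basicOpen_frameDetSection_iff_forall_mem_basicOpen_evalDet` (pointwise) and the HEAD
  **`inf_frameLocus_eq_inf_iInf_basicOpen_evalDet`**:
  `W t ⊓ frameLocus (x_j ≫ ι) = W t ⊓ ⨅_k T_{evalDet^{(k)}_t}`.

## References
* [MumfordFogartyKirwan1994] D. Mumford, J. Fogarty, F. Kirwan, *Geometric Invariant Theory*, 3rd ed. (1994), Ch. 3 §1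
  Definition 3.3 and Proposition 3.1 (p. 68).
* [Hartshorne1977] R. Hartshorne, *Algebraic Geometry* (1977), II Thm. 7.1, II §5 (p. 110).
-/

noncomputable section

set_option backward.isDefEq.respectTransparency false

open CategoryTheory AlgebraicGeometry Opposite TopologicalSpace Limits
open Literature.AlgebraicGeometry.ProjectiveSpace.ProjFrame
open Literature.AlgebraicGeometry.Morphisms Literature.AlgebraicGeometry.Morphisms.ProjFrame

namespace Literature.AlgebraicGeometry.Modules

open Literature.AlgebraicGeometry.Motives Literature.AlgebraicGeometry.Motives.GeneratingSections

section FrameLocus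

variable {X T : Scheme.{0}} (f : X ⟶ T) {L : X.Modules} (FL : FrameSystem L) (h1 : ∀ y, FL.rank y = 1)
  (J : Type) (e : SheafOfModules.free (Fin (Nat.card J + 1)) ≅ ((Scheme.Modules.pushforward f).obj L).over ⊤)
  (hcov : ⨆ i, ⨆ y, X.basicOpen
    ((CocycleSections.ofFrameSystem FL h1 fun j ↦ (basisSection e j :)).coeff i y) = ⊤)
  (x : Fin (Nat.card J + 2) → (T ⟶ X)) (hx : ∀ j, x j ≫ f = 𝟙 T)

/-- **The points `x_j ≫ ι` are the morphisms of the pulled-back generating-sections data** (`ι` the morphism of the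
frame sections `b_i`, Hartshorne II 7.1): `x_j ≫ ι = toProj` of the datum `(x_j^*𝓛, x_j^*b_i)`
(★ `homEquiv_pointOfSections`, ★ `comap_toProj`). [cite: Hartshorne1977, II Thm. 7.1 (b)] -/
theorem comp_homEquiv_pointOfSections_eq_toProj_comap (j : Fin (Nat.card J + 2)) :
    x j ≫ projectiveSpace.homEquiv (Over.mk f) (projectiveSpace.pointOfSections (Over.mk f)
        (ofCocycleSections FL.U (CocycleSections.ofFrameSystem FL h1 fun j ↦ (basisSection e j :)) hcov)) =
      ((ofCocycleSections FL.U (CocycleSections.ofFrameSystem FL h1 fun j ↦ (basisSection e j :)) hcov).comap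
        (x j)).toProj (x j ≫ specULiftZIsTerminal.from X) := by
  rw [projectiveSpace.homEquiv_pointOfSections, comap_toProj]
  rfl


/-- Membership in a finite intersection of opens of a scheme. [folklore] -/
private theorem mem_iInf_iff {Y : Scheme.{0}} {ι : Type} [Finite ι] (U : ι → Y.Opens) (y : Y) :
    y ∈ ⨅ i, U i ↔ ∀ i, y ∈ U i := by
  change y ∈ ((⨅ i, U i : Y.Opens) : Set Y) ↔ _
  rw [Opens.coe_iInf, Set.mem_iInter]
  rfl

/-- **(E6, columns) The chart ratios of the point `x_j ≫ ι` are quotients of pulled-back coefficients**: on any open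
`Ω ≤ x_j⁻¹(X_{c_a^y})` (the locus where the frame section `b_a` generates `L` at `x_j`, read in the local generator of
`L` at `y`), `x_j^*(b_i/b_a) · x_j♯(c_a^y) = x_j♯(c_i^y)` with `x_j♯(c_a^y)` a unit — ★ `ofCocycleSections_ratio_res_mul`
pulled back along `x_j`. [cite: Hartshorne1977, II Thm. 7.1 (b)] [cite: MumfordFogartyKirwan1994, Ch. 3 §1 Proposition 3.1 (p. 68)] -/
theorem appLE_ratio_mul_appLE_coeff (j : Fin (Nat.card J + 2)) (a i : Fin (Nat.card J + 1)) (y : X) {Ω : T.Opens}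
    (hΩ : Ω ≤ (x j) ⁻¹ᵁ X.basicOpen ((CocycleSections.ofFrameSystem FL h1 fun j ↦ (basisSection e j :)).coeff a y)) :
    (x j).appLE _ Ω (hΩ.trans ((x j).preimage_mono (basicOpen_le_ofCocycleSections_U FL.U
        (CocycleSections.ofFrameSystem FL h1 fun j ↦ (basisSection e j :)) hcov a y)))
        ((ofCocycleSections FL.U (CocycleSections.ofFrameSystem FL h1 fun j ↦ (basisSection e j :)) hcov).ratio a i) *
      (x j).appLE (FL.U y) Ω (hΩ.trans ((x j).preimage_mono (X.basicOpen_le _)))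
        ((CocycleSections.ofFrameSystem FL h1 fun j ↦ (basisSection e j :)).coeff a y) =
      (x j).appLE (FL.U y) Ω (hΩ.trans ((x j).preimage_mono (X.basicOpen_le _)))
        ((CocycleSections.ofFrameSystem FL h1 fun j ↦ (basisSection e j :)).coeff i y) := by
  set S := CocycleSections.ofFrameSystem FL h1 fun j ↦ (basisSection e j :) with hS
  have key := ofCocycleSections_ratio_res_mul FL.U S hcov a i y
  have hmap := congrArg ((x j).appLE (X.basicOpen (S.coeff a y)) Ω hΩ) key
  rw [map_mul] at hmap
  -- move the restrictions into `appLE`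
  have h1' : (x j).appLE (X.basicOpen (S.coeff a y)) Ω hΩ
      (X.presheaf.map (homOfLE (basicOpen_le_ofCocycleSections_U FL.U S hcov a y)).op
        ((ofCocycleSections FL.U S hcov).ratio a i)) =
      (x j).appLE _ Ω (hΩ.trans ((x j).preimage_mono (basicOpen_le_ofCocycleSections_U FL.U S hcov a y)))
        ((ofCocycleSections FL.U S hcov).ratio a i) := by
    rw [← CategoryTheory.comp_apply, Scheme.Hom.map_appLE]
  have h2' : ∀ s : Γ(X, FL.U y), (x j).appLE (X.basicOpen (S.coeff a y)) Ω hΩ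
      (X.presheaf.map (homOfLE (X.basicOpen_le (S.coeff a y))).op s) =
      (x j).appLE (FL.U y) Ω (hΩ.trans ((x j).preimage_mono (X.basicOpen_le _))) s := fun s ↦ by
    rw [← CategoryTheory.comp_apply, Scheme.Hom.map_appLE]
  rw [h1', h2', h2'] at hmap
  exact hmap

/-- The pulled-back coefficient `x_j♯(c_a^y)` is a unit on `Ω ≤ x_j⁻¹(X_{c_a^y})`. [cite: Hartshorne1977, II Thm. 7.1 (b)] -/
theorem isUnit_appLE_coeff (j : Fin (Nat.card J + 2)) (a : Fin (Nat.card J + 1)) (y : X) {Ω : T.Opens}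
    (hΩ : Ω ≤ (x j) ⁻¹ᵁ X.basicOpen ((CocycleSections.ofFrameSystem FL h1 fun j ↦ (basisSection e j :)).coeff a y)) :
    IsUnit ((x j).appLE (FL.U y) Ω (hΩ.trans ((x j).preimage_mono (X.basicOpen_le _)))
      ((CocycleSections.ofFrameSystem FL h1 fun j ↦ (basisSection e j :)).coeff a y)) := by
  set S := CocycleSections.ofFrameSystem FL h1 fun j ↦ (basisSection e j :) with hS
  have hu : IsUnit (X.presheaf.map (homOfLE (X.basicOpen_le (S.coeff a y))).op (S.coeff a y)) :=
    RingedSpace.isUnit_res_basicOpen _ (S.coeff a y)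
  have h := hu.map ((x j).appLE (X.basicOpen (S.coeff a y)) Ω hΩ).hom
  rwa [← CategoryTheory.comp_apply, Scheme.Hom.map_appLE] at h


include hx in
/-- **(E6, entries) The evaluation-matrix entry in the pulled-back local generator of `L` is the pulled-back coefficient**:
the coordinate of `ev_{x_j}(b_i)|_{V′}` in the frame `η_{x_j}(FL-frame at x_j(t′))` (★ `FrameSystem.pullback`) is
`x_j♯(c_i^{x_j(t′)})|_{V′}` (★ `evalAtSection_app`, ★ `unitSection_map`, ★ `coord_pullbackFrame_unitSection`).
[cite: Hartshorne1977, II §5 (p. 110)] [cite: MumfordFogartyKirwan1994, Ch. 3 §1 Definition 3.3 (p. 68)] -/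
theorem coord_evalAtSection_app_eq_appLE_coeffAt (j : Fin (Nat.card J + 2)) (i : Fin (Nat.card J + 1)) (t' : T)
    {V' : T.Opens} (hV' : V' ≤ (x j) ⁻¹ᵁ FL.U ((x j).base t')) :
    coord ((FL.pullback (x j)).frame t') (homOfLE hV')
        ((evalAtSection f (x j) (hx j) L).app V'
          (((Scheme.Modules.pushforward f).obj L).presheaf.map (homOfLE (le_top : V' ≤ ⊤)).op (basisSection e i)))
        ((FL.pullback (x j)).idx (fun _ ↦ h1 _) t') =
      (x j).appLE (FL.U ((x j).base t')) V' hV'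
        (coeffAt FL h1 (fun i ↦ (basisSection e i :)) i ((x j).base t')) := by
  haveI : Fintype (FL.I ((x j).base t')) := Fintype.ofEquiv _ (FL.enum _).symm
  -- `ev_{x_j}` on the restricted basis section is the (transported) pulled-back section
  have happ := evalAtSection_app f (x j) (hx j) L V'
    (L.presheaf.map ((Opens.map f.base).map (homOfLE (le_top : V' ≤ ⊤))).op (basisSection e i :))
  change coord _ _ ((evalAtSection f (x j) (hx j) L).app V'
    (show Γ((Scheme.Modules.pushforward f).obj L, V') from
      L.presheaf.map ((Opens.map f.base).map (homOfLE (le_top : V' ≤ ⊤))).op (basisSection e i :))) _ = _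
  rw [happ, unitSection_map]
  -- both restrictions of `η_{x_j}(b_i)` down to `V'`, the second one through `x_j⁻¹(U_y)`
  have hsec : ((Scheme.Modules.pullback (x j)).obj L).presheaf.map
      (eqToHom (eq_preimage_preimage_of_comp_eq_id f (x j) (hx j) V')).op
      (((Scheme.Modules.pullback (x j)).obj L).presheaf.map
        ((Opens.map (x j).base).map ((Opens.map f.base).map (homOfLE (le_top : V' ≤ ⊤)))).op
        (unitSection (x j) L ((Opens.map f.base).obj ⊤) (basisSection e i :))) =
      ((Scheme.Modules.pullback (x j)).obj L).presheaf.map (homOfLE hV').op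
        (((Scheme.Modules.pullback (x j)).obj L).presheaf.map ((Opens.map (x j).base).map
          (homOfLE (le_top : FL.U ((x j).base t') ≤ (Opens.map f.base).obj ⊤))).op
          (unitSection (x j) L ((Opens.map f.base).obj ⊤) (basisSection e i :))) := by
    rw [← CategoryTheory.comp_apply, ← CategoryTheory.comp_apply, ← Functor.map_comp, ← Functor.map_comp]
    congr 2
  rw [hsec]
  erw [← unitSection_map (x j) L (homOfLE (le_top : FL.U ((x j).base t') ≤ (Opens.map f.base).obj ⊤))
    (basisSection e i :)]
  change coord (pullbackFrame (x j) (FL.frame ((x j).base t'))) _ _ _ = _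
  nth_rw 1 [Subsingleton.elim (homOfLE hV') (homOfLE hV' ≫ (Opens.map (x j).base).map (𝟙 (FL.U ((x j).base t'))))]
  rw [coord_map, FL.eq_idx h1 ((x j).base t') ((FL.pullback (x j)).idx (fun _ ↦ h1 _) t')]
  erw [coord_pullbackFrame_unitSection]
  rfl


omit FL h1 e hcov x hx f in
/-- **The frame condition in a chart is the invertibility of all maximal minors of ANY column-normalised matrix of
coordinates** (stalkwise form of MFK Def. 3.3 «`U_R = {D_{0…l̂…d+1} ≠ 0 ∀ l}`»): over an open `V` inside the chart open of
`c`, if a tuple of vectors `P` over `Γ(T, V)` has unit entries `P j (c j)` and reproduces the chart coordinates of the points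
after normalisation (`coord · P j (c j) = P j ·`), then `T_{frameDetSection φ c} ∩ V = V ∩ ⋂_l T_{det (minor P l)}` (germ by germ:
★ `frameDet_map`, ★ `IsUnitFrame.rowScale`, ★ `isUnitFrame_iff_forall_isUnit_det_minor`, ★ `minor_map`).
[cite: MumfordFogartyKirwan1994, Ch. 3 §1 Definition 3.3 (p. 68)] -/
theorem basicOpen_frameDetSection_inf_eq_of_coord_mul
    (φ : Fin (Nat.card J + 2) → (T ⟶ projectiveSpaceInt J)) (c : Fin (Nat.card J + 2) → Fin (Nat.card J + 1))
    {V : T.Opens} (hV : V ≤ chartOpen φ c) (P : Fin (Nat.card J + 2) → Fin (Nat.card J + 1) → Γ(T, V))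
    (hP : ∀ j i, rs hV (ProjFrame.coord φ c j i) * P j (c j) = P j i) (hu : ∀ j, IsUnit (P j (c j))) :
    T.basicOpen (frameDetSection φ c) ⊓ V = V ⊓ ⨅ l, T.basicOpen (minor P l).det := by
  refine Opens.ext (Set.ext fun t' ↦ ?_)
  simp only [Opens.coe_inf, Set.mem_inter_iff, SetLike.mem_coe]
  constructor
  · rintro ⟨hfr, htV⟩
    refine ⟨htV, (mem_iInf_iff _ t').mpr fun l ↦ ?_⟩
    -- germs at `t'`
    have hgerm : IsUnit (T.presheaf.germ V t' htV (rs hV (frameDetSection φ c))) := by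
      rw [TopCat.Presheaf.germ_res_apply T.presheaf (homOfLE hV) t' htV]
      exact (T.mem_basicOpen (frameDetSection φ c) t' (hV htV)).mp hfr
    rw [frameDetSection, show (T.presheaf.germ V t' htV) (rs hV (frameDet (ProjFrame.coord φ c))) =
        frameDet (mapTuple ((T.presheaf.germ V t' htV).hom.comp (rs hV)) (ProjFrame.coord φ c)) from
        frameDet_map ((T.presheaf.germ V t' htV).hom.comp (rs hV)) (ProjFrame.coord φ c),
      isUnit_frameDet_iff] at hgerm
    · -- the germ tuple of `coord` is the germ tuple of `P` rescaled by the inverse units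
      have hPu : IsUnitFrame (mapTuple (T.presheaf.germ V t' htV).hom P) := by
        have h := IsUnitFrame.rowScale (u := fun j ↦ T.presheaf.germ V t' htV (P j (c j)))
          (fun j ↦ (hu j).map _) hgerm
        convert h using 1
        funext j i
        have hPji := congrArg (T.presheaf.germ V t' htV).hom (hP j i)
        rw [map_mul] at hPji
        rw [mapTuple_apply, mapTuple_apply, RingHom.comp_apply, ← hPji, mul_comm]
      rw [isUnitFrame_iff_forall_isUnit_det_minor] at hPu
      have h3 := hPu l
      rw [minor_map, ← RingHom.mapMatrix_apply, ← RingHom.map_det] at h3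
      exact (T.mem_basicOpen _ t' htV).mpr h3
  · rintro ⟨htV, hmin⟩
    refine ⟨?_, htV⟩
    have hPu : IsUnitFrame (mapTuple (T.presheaf.germ V t' htV).hom P) := by
      rw [isUnitFrame_iff_forall_isUnit_det_minor]
      intro l
      rw [minor_map, ← RingHom.mapMatrix_apply, ← RingHom.map_det]
      exact (T.mem_basicOpen _ t' htV).mp ((mem_iInf_iff _ t').mp hmin l)
    -- the germ tuple of `coord` = rescaling of the germ tuple of `P` by the INVERSE units
    have hC : IsUnitFrame (mapTuple ((T.presheaf.germ V t' htV).hom.comp (rs hV)) (ProjFrame.coord φ c)) := by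
      have h := IsUnitFrame.rowScale
        (u := fun j ↦ ((((hu j).map (T.presheaf.germ V t' htV).hom).unit⁻¹ : (T.presheaf.stalk t')ˣ) :
          T.presheaf.stalk t'))
        (fun j ↦ Units.isUnit _) hPu
      convert h using 1
      funext j i
      rw [mapTuple_apply, mapTuple_apply, RingHom.comp_apply]
      have hPji := congrArg (T.presheaf.germ V t' htV).hom (hP j i)
      rw [map_mul] at hPji
      set u := ((hu j).map (T.presheaf.germ V t' htV).hom).unit with hu'
      have huval : (T.presheaf.germ V t' htV).hom (P j (c j)) = (u : T.presheaf.stalk t') := by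
        rw [hu', IsUnit.unit_spec]
      rw [huval] at hPji
      change _ = (↑u⁻¹ : T.presheaf.stalk t') * (T.presheaf.germ V t' htV).hom (P j i)
      rw [← hPji, mul_comm ((T.presheaf.germ V t' htV).hom _) (u : T.presheaf.stalk t'), Units.inv_mul_cancel_left]
    rw [← isUnit_frameDet_iff, ← frameDet_map] at hC
    change IsUnit ((T.presheaf.germ V t' htV) (rs hV (frameDetSection φ c))) at hC
    rw [TopCat.Presheaf.germ_res_apply T.presheaf (homOfLE hV) t' htV] at hC
    exact (T.mem_basicOpen (frameDetSection φ c) t' (hV htV)).mpr hC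


variable (G : ∀ j : Fin (Nat.card J + 2), FrameSystem ((Scheme.Modules.pullback (x j)).obj L))
  (hG : ∀ j t, (G j).rank t = 1)
  (FE : FrameSystem ((Scheme.Modules.pushforward f).obj L)) (hFE : ∀ t, FE.rank t = Nat.card J + 1)
  (W : T → T.Opens) (hW : ∀ t, W t ≤ FE.U t) (hW' : ∀ j t, W t ≤ (G j).U t)

include hx hcov hW hW' hFE hG in
/-- **(E7, pointwise) In a chart, the frame condition for the marked points `x_j ≫ ι` at `t′ ∈ W_t` is the invertibility of
the `d + 2` evaluation determinants `det A^{(l)}_t` (column `l` dropped)** — the chart coordinates are the column-normalised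
pulled-back coefficients (§5 (E6)), the stalkwise frame criterion `basicOpen_frameDetSection_inf_eq_of_coord_mul`, the
identification of the minors with ★ `evalDet` in the pulled-back local generators, and the frame changes `e ⇝ FE_t`,
`η(FL) ⇝ G_j` (★ `basicOpen_evalDet_eq`). [cite: MumfordFogartyKirwan1994, Ch. 3 §1 Definition 3.3 (p. 68)] [cite: Hartshorne1977, II Thm. 7.1 (b)] -/
theorem mem_basicOpen_frameDetSection_iff_forall_mem_basicOpen_evalDet (t t' : T) (ht' : t' ∈ W t)
    (c : Fin (Nat.card J + 2) → Fin (Nat.card J + 1))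
    (hc : t' ∈ chartOpen (fun j ↦ ((ofCocycleSections FL.U (CocycleSections.ofFrameSystem FL h1 fun j ↦ (basisSection e j :))
      hcov).comap (x j)).toProj (x j ≫ specULiftZIsTerminal.from X)) c) :
    t' ∈ T.basicOpen (frameDetSection (fun j ↦ ((ofCocycleSections FL.U
        (CocycleSections.ofFrameSystem FL h1 fun j ↦ (basisSection e j :)) hcov).comap (x j)).toProj
        (x j ≫ specULiftZIsTerminal.from X)) c) ↔
      ∀ l : Fin (Nat.card J + 2), t' ∈ T.basicOpen (FrameSystem.evalDet
        (fun j ↦ evalAtSection f (x (l.succAbove j)) (hx _) L) FE hFE (fun j ↦ G (l.succAbove j))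
        (fun j ↦ hG (l.succAbove j)) W hW (fun j ↦ hW' (l.succAbove j)) t) := by
  classical
  -- names
  set b : Fin (Nat.card J + 1) → Γ(L, ⊤) := fun j ↦ (basisSection e j :) with hb
  set S := CocycleSections.ofFrameSystem FL h1 b with hS
  set D := ofCocycleSections FL.U S hcov with hD
  set φ' : Fin (Nat.card J + 2) → (T ⟶ projectiveSpaceInt J) :=
    fun j ↦ (D.comap (x j)).toProj (x j ≫ specULiftZIsTerminal.from X) with hφ'
  -- instances for the local frames of `L` at the points `x j t'`
  have h1' : ∀ j (t'' : T), (FL.pullback (x j)).rank t'' = 1 := fun j t'' ↦ h1 _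
  haveI hfin : ∀ j, Fintype ((FL.pullback (x j)).I t') := fun j ↦ Fintype.ofEquiv _ (FL.enum _).symm
  haveI hsub : ∀ j, Subsingleton ((FL.pullback (x j)).I t') := fun j ↦ FL.subsingleton_index h1 _
  haveI : Fintype (FE.I t) := Fintype.ofEquiv _ (FE.enum t).symm
  haveI : ∀ j, Fintype ((G j).I t) := fun j ↦ Fintype.ofEquiv _ ((G j).enum t).symm
  haveI : ∀ j, Subsingleton ((G j).I t) := fun j ↦ (G j).subsingleton_index (hG j) t
  -- the chart open of `x_j ≫ ι` is `x_j⁻¹(U_{c j})`, so `((x j).base t') ∈ X_{c_{c j}^{((x j).base t')}}`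
  have hpre : ∀ j a, preU (φ' j) a = (x j) ⁻¹ᵁ D.U a := fun j a ↦
    comap_toProj_preimage_basicOpen D (x j) (specULiftZIsTerminal.from X) a
  have hyc : ∀ j, ((x j).base t') ∈ X.basicOpen (S.coeff (c j) (((x j).base t'))) := by
    intro j
    have h := chartOpen_le φ' c j hc
    rw [hpre] at h
    change (x j).base t' ∈ D.U (c j) at h
    rw [hD, ofCocycleSections_U] at h
    exact (mem_iSup_basicOpen_coeffAt_iff FL h1 b (c j) (((x j).base t'))).mp h
  -- the working open
  set V' : T.Opens := W t ⊓ chartOpen φ' c ⊓ ⨅ j, (x j) ⁻¹ᵁ X.basicOpen (S.coeff (c j) (((x j).base t'))) with hV'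
  have hV'W : V' ≤ W t := inf_le_left.trans inf_le_left
  have hV'c : V' ≤ chartOpen φ' c := inf_le_left.trans inf_le_right
  have hV'S : ∀ j, V' ≤ (x j) ⁻¹ᵁ X.basicOpen (S.coeff (c j) (((x j).base t'))) := fun j ↦ inf_le_right.trans (iInf_le _ j)
  have hV'FL : ∀ j, V' ≤ (x j) ⁻¹ᵁ FL.U (((x j).base t')) := fun j ↦ (hV'S j).trans ((x j).preimage_mono (X.basicOpen_le _))
  have htV' : t' ∈ V' := ⟨⟨ht', hc⟩, (mem_iInf_iff _ t').mpr fun j ↦ hyc j⟩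
  -- the tuple of pulled-back coefficients and its two properties
  set P : Fin (Nat.card J + 2) → Fin (Nat.card J + 1) → Γ(T, V') :=
    fun j i ↦ (x j).appLE (FL.U (((x j).base t'))) V' (hV'FL j) (S.coeff i (((x j).base t'))) with hP
  have hPmul : ∀ j i, rs hV'c (ProjFrame.coord φ' c j i) * P j (c j) = P j i := by
    intro j i
    have key := appLE_ratio_mul_appLE_coeff f FL h1 J e hcov x j (c j) i (((x j).base t')) (hV'S j)
    rw [hP]
    refine Eq.trans ?_ key
    congr 1
    -- `rs (coord) = appLE (ratio)`
    change rs hV'c (rs (chartOpen_le φ' c j) (homRatio (φ' j) (c j) i)) = _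
    rw [rs_rs, homRatio_toProj]
    change (T.presheaf.map _ ≫ T.presheaf.map _) (((D.comap (x j)).ratio (c j) i)) = _
    rw [← Functor.map_comp, comap_ratio, Scheme.Hom.app_eq_appLE]
    change ((x j).appLE _ _ _ ≫ T.presheaf.map _) (D.ratio (c j) i) = _
    rw [Scheme.Hom.appLE_map]
  have hPu : ∀ j, IsUnit (P j (c j)) := fun j ↦ isUnit_appLE_coeff f FL h1 J e x j (c j) ((x j).base t') (hV'S j)
  -- the stalkwise frame criterion on `V'`
  have hX := basicOpen_frameDetSection_inf_eq_of_coord_mul J φ' c hV'c P hPmul hPu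
  -- the minors are the evaluation determinants in the pulled-back local generators
  have hmin : ∀ l, (minor P l).det = evalDet (fun k' ↦ evalAtSection f (x (l.succAbove k')) (hx _) L) e
      (Equiv.refl _) (homOfLE (le_top : V' ≤ ⊤)) (fun k' ↦ (FL.pullback (x (l.succAbove k'))).frame t')
      (fun k' ↦ (FL.pullback (x (l.succAbove k'))).idx (h1' (l.succAbove k')) t') (fun k' ↦ homOfLE (hV'FL _)) := by
    intro l
    rw [evalDet_eq_det]
    congr 1
    ext i k'
    rw [minor_apply, evalMatrix_apply, Equiv.refl_symm, Equiv.refl_apply, hP]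
    exact (coord_evalAtSection_app_eq_appLE_coeffAt f FL h1 J e x hx (l.succAbove k') i t' (hV'FL _)).symm
  -- frame change `(e, η(FL)) ⇝ (FE_t, G_t)` and restriction from `W t` to `V'`
  have hchange : ∀ l, T.basicOpen (minor P l).det = V' ⊓ T.basicOpen (FrameSystem.evalDet
      (fun j ↦ evalAtSection f (x (l.succAbove j)) (hx _) L) FE hFE (fun j ↦ G (l.succAbove j))
      (fun j ↦ hG (l.succAbove j)) W hW (fun j ↦ hW' (l.succAbove j)) t) := by
    intro l
    have hres := FrameSystem.map_evalDet (fun j ↦ evalAtSection f (x (l.succAbove j)) (hx _) L) FE hFE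
      (fun j ↦ G (l.succAbove j)) (fun j ↦ hG (l.succAbove j)) W hW (fun j ↦ hW' (l.succAbove j)) (t := t)
      (homOfLE hV'W)
    have hbo := T.basicOpen_res (FrameSystem.evalDet (fun j ↦ evalAtSection f (x (l.succAbove j)) (hx _) L) FE hFE
      (fun j ↦ G (l.succAbove j)) (fun j ↦ hG (l.succAbove j)) W hW (fun j ↦ hW' (l.succAbove j)) t) (homOfLE hV'W).op
    rw [hres] at hbo
    rw [hmin, ← hbo]
    exact (basicOpen_evalDet_eq (fun k' ↦ evalAtSection f (x (l.succAbove k')) (hx _) L)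
      e (FE.frame t) (Equiv.refl _) ((FE.enum t).trans (finCongr (hFE t)))
      (homOfLE (le_top : V' ≤ ⊤)) (homOfLE hV'W ≫ homOfLE (hW t))
      (fun k' ↦ (FL.pullback (x (l.succAbove k'))).frame t') (fun k' ↦ (G (l.succAbove k')).frame t)
      (fun k' ↦ (FL.pullback (x (l.succAbove k'))).idx (h1' (l.succAbove k')) t') (fun k' ↦ (G (l.succAbove k')).idx (hG _) t)
      (fun k' ↦ ((FL.pullback (x (l.succAbove k'))).enum t').trans (finCongr (h1' (l.succAbove k') t')))
      (fun k' ↦ ((G (l.succAbove k')).enum t).trans (finCongr (hG _ t)))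
      (fun k' ↦ homOfLE (hV'FL _)) (fun k' ↦ homOfLE hV'W ≫ homOfLE (hW' _ t))).symm
  -- conclude at the point `t'`
  constructor
  · intro hfr l
    have h : t' ∈ T.basicOpen (frameDetSection φ' c) ⊓ V' := ⟨hfr, htV'⟩
    rw [hX] at h
    obtain ⟨-, h⟩ := h
    change t' ∈ ((⨅ l, T.basicOpen (minor P l).det : T.Opens) : Set T) at h
    rw [Opens.coe_iInf] at h
    have hl := Set.mem_iInter.mp h l
    change t' ∈ T.basicOpen (minor P l).det at hl
    rw [hchange] at hl
    exact hl.2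
  · intro hall
    have h : t' ∈ V' ⊓ ⨅ l, T.basicOpen (minor P l).det := by
      refine ⟨htV', ?_⟩
      change t' ∈ ((⨅ l, T.basicOpen (minor P l).det : T.Opens) : Set T)
      rw [Opens.coe_iInf]
      refine Set.mem_iInter.mpr fun l ↦ ?_
      change t' ∈ T.basicOpen (minor P l).det
      rw [hchange]
      exact ⟨htV', hall l⟩
    rw [← hX] at h
    exact h.1

/-- **(E7) The chart seam, head form: on the refinement `W t`, the frame locus of the `d + 2` points `x_j ≫ ι`
(`ι : X ⟶ ℙ^d` the morphism of the frame sections `b₀, …, b_d` of `f_*𝓛`, Hartshorne II 7.1 (b); MFK's open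
`U_R` of Definition 3.3 pulled back along the tuple) is cut out by the `d + 2` evaluation determinants
`det (b_i(x_{j}))_{i, j ≠ k}` read in ANY local frames `FE_t` of `f_*𝓛` and `G_j` of `x_j^*𝓛`.**
[cite: MumfordFogartyKirwan1994, Ch. 3 §1 Definition 3.3 (p. 68)] [cite: Hartshorne1977, II Thm. 7.1 (b)] -/
theorem inf_frameLocus_eq_inf_iInf_basicOpen_evalDet (t : T) :
    W t ⊓ ProjFrame.frameLocus (fun j ↦ x j ≫ projectiveSpace.homEquiv (Over.mk f)
        (projectiveSpace.pointOfSections (Over.mk f)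
          (ofCocycleSections FL.U (CocycleSections.ofFrameSystem FL h1 fun j ↦ (basisSection e j :)) hcov))) =
      W t ⊓ ⨅ k : Fin (Nat.card J + 2), T.basicOpen (FrameSystem.evalDet
        (fun j ↦ evalAtSection f (x (k.succAbove j)) (hx _) L) FE hFE (fun j ↦ G (k.succAbove j))
        (fun j ↦ hG (k.succAbove j)) W hW (fun j ↦ hW' (k.succAbove j)) t) := by
  have hφ : (fun j ↦ x j ≫ projectiveSpace.homEquiv (Over.mk f) (projectiveSpace.pointOfSections (Over.mk f)
      (ofCocycleSections FL.U (CocycleSections.ofFrameSystem FL h1 fun j ↦ (basisSection e j :)) hcov))) =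
      fun j ↦ ((ofCocycleSections FL.U (CocycleSections.ofFrameSystem FL h1 fun j ↦ (basisSection e j :))
        hcov).comap (x j)).toProj (x j ≫ specULiftZIsTerminal.from X) :=
    funext fun j ↦ comp_homEquiv_pointOfSections_eq_toProj_comap f FL h1 J e hcov x j
  rw [hφ]
  refine Opens.ext (Set.ext fun t' ↦ ⟨fun ht ↦ ⟨ht.1, ?_⟩, fun ht ↦ ⟨ht.1, ?_⟩⟩)
  · obtain ⟨c, hc⟩ := (mem_frameLocus_iff _ t').mp ht.2
    exact (mem_iInf_iff _ t').mpr ((mem_basicOpen_frameDetSection_iff_forall_mem_basicOpen_evalDet f FL h1 J e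
      hcov x hx G hG FE hFE W hW hW' t t' ht.1 c (basicOpen_frameDetSection_le_chartOpen _ c hc)).mp hc)
  · have hch : ∀ j, ∃ a, t' ∈ preU (((ofCocycleSections FL.U (CocycleSections.ofFrameSystem FL h1
        fun j ↦ (basisSection e j :)) hcov).comap (x j)).toProj (x j ≫ specULiftZIsTerminal.from X)) a := by
      intro j
      refine Opens.mem_iSup.mp ?_
      rw [iSup_preU]
      trivial
    choose c hc using hch
    exact (mem_frameLocus_iff _ t').mpr ⟨c, (mem_basicOpen_frameDetSection_iff_forall_mem_basicOpen_evalDet f FL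
      h1 J e hcov x hx G hG FE hFE W hW hW' t t' ht.1 c ((mem_iInf_iff _ t').mpr hc)).mpr
        ((mem_iInf_iff _ t').mp ht.2)⟩

end FrameLocus

end Literature.AlgebraicGeometry.Modules

end
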